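import Summits.QuantumFields.BalabanUV.Beta.D1BFx.ProjectorJet
import Literature.Analysis.Calculus.MatrixFieldDeriv

/-!
# `BalabanUV.Beta.D1BFx.ProjectorJetDeriv` — road «BF-x» for binder row D1, leaf J5 (MODEL LEVEL), the CALCULUS READING:
# along a differentiable one-parameter family of column families `X t` with unit Gram matrix at `t₀`, the coprojector
# `t ↦ coproj (X t)` is differentiable at `t₀` and ITS DERIVATIVE IS `ProjectorJet.cojet (X t₀) Ẋ`; the [B9] (3.25) curve
# `t ↦ coproj ((H t)⁻¹ (Q t)ᴴ)` has derivative `cojet X₀ (−H₀⁻¹·Ḣ·X₀ + H₀⁻¹·Q̇ᴴ)` (= `ProjectorJet.cojet_balaban`'s four terms)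

HONEST FRAMING (cell contract, verbatim): «discharging `BetaPertH` makes Bałaban's UV stability UNCONDITIONAL — a real
constructive-QFT result; it is NOT the continuum limit and NOT the Clay problem.»  HONEST DEPENDENCY (verbatim): «continuum YM on
T⁴ ⇐ BetaPertH ∧ nine spine estimates (0/9 proved); BetaPertH ⇐ (D1) ∧ (D4) ∧ CAP+tail; G-an2-4 gates asym, D1 and NE2/3/4.»
[folklore] one-variable real calculus of matrix curves, ENTRYWISE (every `HasDerivAt` below is a statement about a real-valued
function, so no norm on `Matrix` is chosen), composed BY NAME from Mathlib (`HasDerivAt.fun_sum`, `.fun_mul`, `.unique`,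
`.congr_of_eventuallyEq`, `hasDerivAt_pi`) and the tree's `Literature.Analysis.Calculus.MatrixFieldDeriv` (`differentiableAt_inv_apply`,
`eventually_det_ne_zero`, `fderiv_inv_apply` — the derivative of the inverse matrix).  The IDENTIFICATION of the derivative is
`ProjectorJet.cojet_unique` (p211500): differentiate the three identities `Rᴴ = R`, `R·R = R`, `R·X = 0` (the last two hold on a
neighbourhood of `t₀`, where the Gram matrix stays a unit).  Cites nothing as a hypothesis, mints no `Prop`; 0 binders of row D1
instantiated; NOT D1, NOT BetaPertH, NOT continuum, NOT Clay.

CONTENT.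
* §1 `hasDerivAt_mul_apply`, `differentiableAt_mul_apply`, `hasDerivAt_conjTranspose_apply` — entrywise Leibniz rule for matrix
  curves over `ℝ` and the (trivial-star) transpose.
* §2 `hasDerivAt_inv_apply` — curve form of the tree's inverse rule: `((A t)⁻¹)˙ = −A⁻¹·Ȧ·A⁻¹` entrywise at a point where `det A ≠ 0`.
* §3 **`hasDerivAt_coproj_apply`**: `∀ i j, HasDerivAt (t ↦ coproj (X t) i j) (cojet (X t₀) Ẋ i j) t₀` from entrywise
  `HasDerivAt (t ↦ X t i k) (Ẋ i k) t₀` and `IsUnit ((X t₀)ᴴ X t₀)`; Pi-valued form `hasDerivAt_coproj`.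
* §4 **`hasDerivAt_coproj_balaban_apply`**: for curves `H t` (with `det H t₀ ≠ 0`) and `Q t`, the column family
  `X t := (H t)⁻¹ (Q t)ᴴ` has entrywise derivative `Ẋ = −H₀⁻¹·Ḣ·X₀ + H₀⁻¹·Q̇ᴴ` (`hasDerivAt_invMulConjTranspose_apply`), hence
  `t ↦ coproj (X t)` has derivative `cojet X₀ Ẋ` — whose closed four-term form is `ProjectorJet.cojet_balaban(_of_isHermitian)`.
-/

namespace Summit.QuantumFields.BalabanUV.Beta.D1BFx.ProjectorJetDeriv

open Matrix Filter
open scoped Topology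
open Summit.QuantumFields.BalabanUV.Beta.GAN24.WoodburyFibreGaugeSection
  (coproj coproj_conjTranspose coproj_mul_coproj coproj_mul_self)
open Summit.QuantumFields.BalabanUV.Beta.D1BFx.ProjectorJet (pinv cojet cojet_unique)

noncomputable section

/-! ## §1 Entrywise Leibniz rule for matrix curves -/

section Leibniz

variable {p q r : Type*} [Fintype q]

/-- [folklore] **Entrywise Leibniz rule**: if every entry of the matrix curves `A`, `B` is differentiable at `t` with derivatives
`A'`, `B'`, then every entry of `t ↦ A t · B t` is, with derivative `(A'·B t + A t·B')ᵢⱼ`. -/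
theorem hasDerivAt_mul_apply {A : ℝ → Matrix p q ℝ} {B : ℝ → Matrix q r ℝ} {A' : Matrix p q ℝ} {B' : Matrix q r ℝ} {t : ℝ}
    (hA : ∀ i k, HasDerivAt (fun s => A s i k) (A' i k) t) (hB : ∀ k j, HasDerivAt (fun s => B s k j) (B' k j) t)
    (i : p) (j : r) : HasDerivAt (fun s => (A s * B s) i j) ((A' * B t + A t * B') i j) t := by
  simp only [Matrix.mul_apply, Matrix.add_apply, ← Finset.sum_add_distrib]
  exact HasDerivAt.fun_sum fun k _ => (hA i k).fun_mul (hB k j)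

/-- [folklore] Entrywise differentiability of a product of entrywise differentiable matrix curves. -/
theorem differentiableAt_mul_apply {A : ℝ → Matrix p q ℝ} {B : ℝ → Matrix q r ℝ} {t : ℝ}
    (hA : ∀ i k, DifferentiableAt ℝ (fun s => A s i k) t) (hB : ∀ k j, DifferentiableAt ℝ (fun s => B s k j) t)
    (i : p) (j : r) : DifferentiableAt ℝ (fun s => (A s * B s) i j) t := by
  simp only [Matrix.mul_apply]
  exact DifferentiableAt.fun_sum fun k _ => (hA i k).fun_mul (hB k j)

omit [Fintype q] in
/-- [folklore] Over `ℝ` (trivial star) the conjugate transpose of a differentiable curve is differentiable, entry by entry. -/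
theorem hasDerivAt_conjTranspose_apply {A : ℝ → Matrix p q ℝ} {A' : Matrix p q ℝ} {t : ℝ}
    (hA : ∀ i k, HasDerivAt (fun s => A s i k) (A' i k) t) (k : q) (i : p) :
    HasDerivAt (fun s => (A s)ᴴ k i) (A'ᴴ k i) t := by
  simp only [conjTranspose_apply, star_trivial]
  exact hA i k

omit [Fintype q] in
/-- [folklore] The same, differentiability form. -/
theorem differentiableAt_conjTranspose_apply {A : ℝ → Matrix p q ℝ} {t : ℝ}
    (hA : ∀ i k, DifferentiableAt ℝ (fun s => A s i k) t) (k : q) (i : p) :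
    DifferentiableAt ℝ (fun s => (A s)ᴴ k i) t := by
  simp only [conjTranspose_apply, star_trivial]
  exact hA i k

end Leibniz

/-! ## §2 The inverse of a matrix curve (curve form of the tree's `MatrixFieldDeriv` rule) -/

section Inverse

variable {q : Type*} [Fintype q] [DecidableEq q]

omit [DecidableEq q] in
/-- [folklore] Packaging: entrywise derivatives of a square matrix curve give a Fréchet derivative of the curve read as
`ℝ → q → q → ℝ` (product norm), the currency of `Literature.Analysis.Calculus.MatrixFieldDeriv`. -/
theorem hasFDerivAt_pi_of_apply {A : ℝ → Matrix q q ℝ} {A' : Matrix q q ℝ} {t : ℝ}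
    (hA : ∀ i k, HasDerivAt (fun s => A s i k) (A' i k) t) :
    HasFDerivAt (fun s => (fun i k => A s i k : q → q → ℝ))
      (ContinuousLinearMap.smulRight (1 : ℝ →L[ℝ] ℝ) (fun i k => A' i k : q → q → ℝ)) t := by
  have h : HasDerivAt (fun s => (fun i k => A s i k : q → q → ℝ)) (fun i k => A' i k : q → q → ℝ) t :=
    hasDerivAt_pi.2 fun i => hasDerivAt_pi.2 fun k => hA i k
  exact h.hasFDerivAt

/-- [folklore] Near a point where `det A ≠ 0` the determinant of an entrywise differentiable curve stays non-zero, so the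
matrix stays a unit. -/
theorem eventually_isUnit {A : ℝ → Matrix q q ℝ} {A' : Matrix q q ℝ} {t : ℝ}
    (hA : ∀ i k, HasDerivAt (fun s => A s i k) (A' i k) t) (hdet : (A t).det ≠ 0) : ∀ᶠ s in 𝓝 t, IsUnit (A s) := by
  have h := Literature.Analysis.Calculus.eventually_det_ne_zero (hasFDerivAt_pi_of_apply hA) hdet
  exact h.mono fun s hs => (Matrix.isUnit_iff_isUnit_det _).mpr (isUnit_iff_ne_zero.mpr hs)

/-- [folklore] Entries of the inverse of an entrywise differentiable curve are differentiable where `det ≠ 0`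
(the tree's `differentiableAt_inv_apply`, curve form). -/
theorem differentiableAt_inv_apply {A : ℝ → Matrix q q ℝ} {A' : Matrix q q ℝ} {t : ℝ}
    (hA : ∀ i k, HasDerivAt (fun s => A s i k) (A' i k) t) (hdet : (A t).det ≠ 0) (k l : q) :
    DifferentiableAt ℝ (fun s => (A s)⁻¹ k l) t :=
  Literature.Analysis.Calculus.differentiableAt_inv_apply (hasFDerivAt_pi_of_apply hA) hdet k l

/-- [folklore] **THE INVERSE RULE, CURVE FORM**: `HasDerivAt (s ↦ (A s)⁻¹ k l) (−(A⁻¹·A'·A⁻¹) k l) t` at a point with `det A t ≠ 0`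
(the tree's `fderiv_inv_apply` read at the unit tangent vector). -/
theorem hasDerivAt_inv_apply {A : ℝ → Matrix q q ℝ} {A' : Matrix q q ℝ} {t : ℝ}
    (hA : ∀ i k, HasDerivAt (fun s => A s i k) (A' i k) t) (hdet : (A t).det ≠ 0) (k l : q) :
    HasDerivAt (fun s => (A s)⁻¹ k l) (-((A t)⁻¹ * A' * (A t)⁻¹) k l) t := by
  have hF := hasFDerivAt_pi_of_apply hA
  have hd : HasDerivAt (fun s => (A s)⁻¹ k l) (deriv (fun s => (A s)⁻¹ k l) t) t :=
    (Literature.Analysis.Calculus.differentiableAt_inv_apply hF hdet k l).hasDerivAt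
  have hval : deriv (fun s => (A s)⁻¹ k l) t = -((A t)⁻¹ * A' * (A t)⁻¹) k l := by
    have h := Literature.Analysis.Calculus.fderiv_inv_apply hF hdet k l 1
    simp only [ContinuousLinearMap.smulRight_apply, one_apply_eq_self, one_smul] at h
    exact h
  rw [← hval]
  exact hd

end Inverse

/-! ## §3 The derivative of the coprojector IS `cojet` -/

section Coproj

variable {n m : Type*} [Fintype n] [Fintype m] [DecidableEq n] [DecidableEq m]

omit [Fintype m] [DecidableEq n] [DecidableEq m] in
/-- [folklore] Entries of the Gram curve `t ↦ (X t)ᴴ X t` are differentiable with derivative `Ẋᴴ X + Xᴴ Ẋ`. -/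
theorem hasDerivAt_gram_apply {X : ℝ → Matrix n m ℝ} {X' : Matrix n m ℝ} {t : ℝ}
    (hX : ∀ i k, HasDerivAt (fun s => X s i k) (X' i k) t) (k l : m) :
    HasDerivAt (fun s => ((X s)ᴴ * X s) k l) ((X'ᴴ * X t + (X t)ᴴ * X') k l) t :=
  hasDerivAt_mul_apply (hasDerivAt_conjTranspose_apply hX) hX k l

/-- [folklore] Entries of `t ↦ coproj (X t)` are differentiable at a point where the Gram matrix is a unit. -/
theorem differentiableAt_coproj_apply {X : ℝ → Matrix n m ℝ} {X' : Matrix n m ℝ} {t : ℝ}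
    (hX : ∀ i k, HasDerivAt (fun s => X s i k) (X' i k) t) (hG : IsUnit ((X t)ᴴ * X t)) (i j : n) :
    DifferentiableAt ℝ (fun s => coproj (X s) i j) t := by
  have hdet : ((X t)ᴴ * X t).det ≠ 0 := ((Matrix.isUnit_iff_isUnit_det _).mp hG).ne_zero
  have hinv : ∀ k l, DifferentiableAt ℝ (fun s => ((X s)ᴴ * X s)⁻¹ k l) t :=
    fun k l => differentiableAt_inv_apply (A := fun s => (X s)ᴴ * X s) (hasDerivAt_gram_apply hX) hdet k l
  have hXd : ∀ i k, DifferentiableAt ℝ (fun s => X s i k) t := fun i k => (hX i k).differentiableAt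
  have h3 : DifferentiableAt ℝ (fun s => (X s * ((X s)ᴴ * X s)⁻¹ * (X s)ᴴ) i j) t :=
    differentiableAt_mul_apply (differentiableAt_mul_apply hXd hinv) (differentiableAt_conjTranspose_apply hXd) i j
  have heq : (fun s => coproj (X s) i j) = fun s => (1 : Matrix n n ℝ) i j - (X s * ((X s)ᴴ * X s)⁻¹ * (X s)ᴴ) i j := by
    funext s; rw [coproj, Matrix.sub_apply]
  rw [heq]
  exact (differentiableAt_const _).sub h3

/-- [folklore] **THE DERIVATIVE OF THE COPROJECTOR IS `cojet`.**  If every entry of the column-family curve `X` is differentiable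
at `t₀` with derivative `Ẋ = X'` and the Gram matrix `(X t₀)ᴴ X t₀` is a unit, then every entry of `t ↦ coproj (X t)` is
differentiable at `t₀` with derivative `(cojet (X t₀) X')ᵢⱼ`.  Proof: the entrywise derivative `Z` exists (§2); differentiating
`Rᴴ = R`, and — on the neighbourhood of `t₀` where the Gram matrix stays a unit — `R·R = R` and `R·X = 0`, gives the three Leibniz
identities; `ProjectorJet.cojet_unique` identifies `Z`. -/
theorem hasDerivAt_coproj_apply {X : ℝ → Matrix n m ℝ} {X' : Matrix n m ℝ} {t₀ : ℝ}
    (hX : ∀ i k, HasDerivAt (fun s => X s i k) (X' i k) t₀) (hG : IsUnit ((X t₀)ᴴ * X t₀)) (i j : n) :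
    HasDerivAt (fun s => coproj (X s) i j) (cojet (X t₀) X' i j) t₀ := by
  -- the entrywise derivative exists; name it `Z`
  set Z : Matrix n n ℝ := Matrix.of fun i j => deriv (fun s => coproj (X s) i j) t₀ with hZdef
  have hRd : ∀ i j, HasDerivAt (fun s => coproj (X s) i j) (Z i j) t₀ := fun i j => by
    rw [hZdef, Matrix.of_apply]
    exact (differentiableAt_coproj_apply hX hG i j).hasDerivAt
  -- the Gram matrix stays a unit near `t₀`
  have hdet : ((X t₀)ᴴ * X t₀).det ≠ 0 := ((Matrix.isUnit_iff_isUnit_det _).mp hG).ne_zero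
  have hev : ∀ᶠ s in 𝓝 t₀, IsUnit ((X s)ᴴ * X s) :=
    eventually_isUnit (A := fun s => (X s)ᴴ * X s) (hasDerivAt_gram_apply hX) hdet
  -- (a) `Z` is Hermitian: `R` is, pointwise in `s`
  have hsym : ∀ s i j, coproj (X s) j i = coproj (X s) i j := fun s i j => by
    have h := congrFun (congrFun (coproj_conjTranspose (X s)) i) j
    rwa [conjTranspose_apply, star_trivial] at h
  have ha : Zᴴ = Z := by
    ext i j
    rw [conjTranspose_apply, star_trivial, hZdef, Matrix.of_apply, Matrix.of_apply]
    exact congrArg (fun f : ℝ → ℝ => deriv f t₀) (funext fun s => hsym s i j)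
  -- (b) Leibniz for `R·R = R`
  have hb : coproj (X t₀) * Z + Z * coproj (X t₀) = Z := by
    rw [add_comm]
    ext i j
    have h1 : HasDerivAt (fun s => (coproj (X s) * coproj (X s)) i j) ((Z * coproj (X t₀) + coproj (X t₀) * Z) i j) t₀ :=
      hasDerivAt_mul_apply hRd hRd i j
    have h2 : HasDerivAt (fun s => (coproj (X s) * coproj (X s)) i j) (Z i j) t₀ :=
      (hRd i j).congr_of_eventuallyEq (hev.mono fun s hs => by simp only [coproj_mul_coproj hs])
    exact h1.unique h2
  -- (c) Leibniz for `R·X = 0`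
  have hc : Z * X t₀ + coproj (X t₀) * X' = 0 := by
    ext i k
    have h1 : HasDerivAt (fun s => (coproj (X s) * X s) i k) ((Z * X t₀ + coproj (X t₀) * X') i k) t₀ :=
      hasDerivAt_mul_apply hRd hX i k
    have h2 : HasDerivAt (fun s => (coproj (X s) * X s) i k) 0 t₀ :=
      (hasDerivAt_const t₀ (0 : ℝ)).congr_of_eventuallyEq
        (hev.mono fun s hs => by simp only [coproj_mul_self hs, Matrix.zero_apply])
    rw [Matrix.zero_apply]
    exact h1.unique h2
  -- identification
  have hZ : Z = cojet (X t₀) X' := cojet_unique ha hb hc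
  rw [← hZ]
  exact hRd i j

/-- [folklore] The same in the product-normed currency `ℝ → n → n → ℝ`: `t ↦ coproj (X t)` HAS DERIVATIVE `cojet (X t₀) Ẋ` at `t₀`. -/
theorem hasDerivAt_coproj {X : ℝ → Matrix n m ℝ} {X' : Matrix n m ℝ} {t₀ : ℝ}
    (hX : ∀ i k, HasDerivAt (fun s => X s i k) (X' i k) t₀) (hG : IsUnit ((X t₀)ᴴ * X t₀)) :
    HasDerivAt (fun s => (fun i j => coproj (X s) i j : n → n → ℝ)) (fun i j => cojet (X t₀) X' i j : n → n → ℝ) t₀ :=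
  hasDerivAt_pi.2 fun i => hasDerivAt_pi.2 fun j => hasDerivAt_coproj_apply hX hG i j

/-- [folklore] Consequently the derivative, read as a matrix, satisfies the three Leibniz identities and is off-diagonal
(`R·Ṙ·R = 0`, `P·Ṙ·P = 0`) — `ProjectorJet` §3 applies verbatim to `deriv`. -/
theorem deriv_coproj_apply {X : ℝ → Matrix n m ℝ} {X' : Matrix n m ℝ} {t₀ : ℝ}
    (hX : ∀ i k, HasDerivAt (fun s => X s i k) (X' i k) t₀) (hG : IsUnit ((X t₀)ᴴ * X t₀)) (i j : n) :
    deriv (fun s => coproj (X s) i j) t₀ = cojet (X t₀) X' i j :=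
  (hasDerivAt_coproj_apply hX hG i j).deriv

end Coproj

/-! ## §4 The [B9] (3.25) curve `X t = (H t)⁻¹ (Q t)ᴴ` -/

section Balaban

variable {n m : Type*} [Fintype n] [Fintype m] [DecidableEq n] [DecidableEq m]

omit [Fintype m] [DecidableEq m] in
/-- [folklore] **THE COLUMN VARIATION OF `X = H⁻¹Qᴴ`.**  For entrywise differentiable curves `H` (with `det H t₀ ≠ 0`,
derivative `V`) and `Q` (derivative `Q'`), the column family `X t := (H t)⁻¹ (Q t)ᴴ` has entrywise derivative
`Ẋ = −H₀⁻¹·V·X₀ + H₀⁻¹·Q'ᴴ` at `t₀` (inverse rule + Leibniz). -/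
theorem hasDerivAt_invMulConjTranspose_apply {H : ℝ → Matrix n n ℝ} {V : Matrix n n ℝ} {Q : ℝ → Matrix m n ℝ}
    {Q' : Matrix m n ℝ} {t₀ : ℝ} (hH : ∀ i k, HasDerivAt (fun s => H s i k) (V i k) t₀) (hdet : (H t₀).det ≠ 0)
    (hQ : ∀ l k, HasDerivAt (fun s => Q s l k) (Q' l k) t₀) (i : n) (l : m) :
    HasDerivAt (fun s => ((H s)⁻¹ * (Q s)ᴴ) i l)
      ((-((H t₀)⁻¹ * V * ((H t₀)⁻¹ * (Q t₀)ᴴ)) + (H t₀)⁻¹ * Q'ᴴ) i l) t₀ := by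
  have h := hasDerivAt_mul_apply (A := fun s => (H s)⁻¹) (B := fun s => (Q s)ᴴ) (hasDerivAt_inv_apply hH hdet)
    (hasDerivAt_conjTranspose_apply hQ) i l
  have e : -((H t₀)⁻¹ * V * (H t₀)⁻¹) * (Q t₀)ᴴ + (H t₀)⁻¹ * Q'ᴴ = -((H t₀)⁻¹ * V * ((H t₀)⁻¹ * (Q t₀)ᴴ)) + (H t₀)⁻¹ * Q'ᴴ := by
    rw [Matrix.neg_mul, Matrix.mul_assoc]
  rw [← e]
  exact h

/-- [folklore] **THE DERIVATIVE OF BAŁABAN'S COPROJECTOR CURVE.**  With `X t := (H t)⁻¹ (Q t)ᴴ` as above and a unit Gram matrix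
at `t₀`, every entry of `t ↦ coproj (X t)` ([B9] (3.25): `R(U) = 1 − G′Q′*(Q′G′²Q′*)⁻¹Q′G′` along a one-parameter background, at
the model level) has derivative `(cojet X₀ (−H₀⁻¹·V·X₀ + H₀⁻¹·Q'ᴴ))ᵢⱼ` — the four-term closed form of which is
`ProjectorJet.cojet_balaban` (`R·H⁻¹·V·P + (R·H⁻¹·V·P)ᴴ − (R·H⁻¹·Q'ᴴ·X⁺ + h.c.)`). -/
theorem hasDerivAt_coproj_balaban_apply {H : ℝ → Matrix n n ℝ} {V : Matrix n n ℝ} {Q : ℝ → Matrix m n ℝ}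
    {Q' : Matrix m n ℝ} {t₀ : ℝ} (hH : ∀ i k, HasDerivAt (fun s => H s i k) (V i k) t₀) (hdet : (H t₀).det ≠ 0)
    (hQ : ∀ l k, HasDerivAt (fun s => Q s l k) (Q' l k) t₀)
    (hG : IsUnit (((H t₀)⁻¹ * (Q t₀)ᴴ)ᴴ * ((H t₀)⁻¹ * (Q t₀)ᴴ))) (i j : n) :
    HasDerivAt (fun s => coproj ((H s)⁻¹ * (Q s)ᴴ) i j)
      (cojet ((H t₀)⁻¹ * (Q t₀)ᴴ) (-((H t₀)⁻¹ * V * ((H t₀)⁻¹ * (Q t₀)ᴴ)) + (H t₀)⁻¹ * Q'ᴴ) i j) t₀ :=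
  hasDerivAt_coproj_apply (X := fun s => (H s)⁻¹ * (Q s)ᴴ) (hasDerivAt_invMulConjTranspose_apply hH hdet hQ) hG i j

/-- [folklore] The same with the closed form substituted: the derivative entry is
`(R·H⁻¹·V·P + (R·H⁻¹·V·P)ᴴ − (R·H⁻¹·Q'ᴴ·X⁺ + (R·H⁻¹·Q'ᴴ·X⁺)ᴴ))ᵢⱼ`, `R = coproj X₀`, `P = 1 − R`, `X⁺ = pinv X₀`. -/
theorem hasDerivAt_coproj_balaban_apply' {H : ℝ → Matrix n n ℝ} {V : Matrix n n ℝ} {Q : ℝ → Matrix m n ℝ}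
    {Q' : Matrix m n ℝ} {t₀ : ℝ} (hH : ∀ i k, HasDerivAt (fun s => H s i k) (V i k) t₀) (hdet : (H t₀).det ≠ 0)
    (hQ : ∀ l k, HasDerivAt (fun s => Q s l k) (Q' l k) t₀)
    (hG : IsUnit (((H t₀)⁻¹ * (Q t₀)ᴴ)ᴴ * ((H t₀)⁻¹ * (Q t₀)ᴴ))) (i j : n) :
    HasDerivAt (fun s => coproj ((H s)⁻¹ * (Q s)ᴴ) i j)
      ((coproj ((H t₀)⁻¹ * (Q t₀)ᴴ) * (H t₀)⁻¹ * V * (1 - coproj ((H t₀)⁻¹ * (Q t₀)ᴴ)) +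
          (coproj ((H t₀)⁻¹ * (Q t₀)ᴴ) * (H t₀)⁻¹ * V * (1 - coproj ((H t₀)⁻¹ * (Q t₀)ᴴ)))ᴴ -
        (coproj ((H t₀)⁻¹ * (Q t₀)ᴴ) * (H t₀)⁻¹ * Q'ᴴ * pinv ((H t₀)⁻¹ * (Q t₀)ᴴ) +
          (coproj ((H t₀)⁻¹ * (Q t₀)ᴴ) * (H t₀)⁻¹ * Q'ᴴ * pinv ((H t₀)⁻¹ * (Q t₀)ᴴ))ᴴ) : Matrix n n ℝ) i j) t₀ := by
  rw [← ProjectorJet.cojet_balaban]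
  exact hasDerivAt_coproj_balaban_apply hH hdet hQ hG i j

end Balaban

end

end Summit.QuantumFields.BalabanUV.Beta.D1BFx.ProjectorJetDeriv
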